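import Summits.NavierStokesRegularity.NavierStokesRegularity.Theorems.CoriolisHeadTypeIRatePressureKernel
import HarnessLib

/-!
# CoriolisHeadTypeIRateHessianKernel — crux `NoCoRotatingCore` (stmt-NavierStokesRegularity-22676), line
# `far_field_constancy` v2 (15c9a82ad206abb9), stub K1c: dyadic shell steps of the PRESSURE HESSIAN `∂ₑ∂_{e'}P`

Generic potential theory on `ℝ³` (no profile system), one derivative above `CoriolisHeadTypeIRatePressureKernel`.
With `S_c = ∫ λ^{c,2c}(z) ∂ₑ∂_{e'}P(y + z) dz`, `K_c = Γ∞^{c,2c} − Γ∞^{2c,4c}`: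
§1 generic decay integrals for a continuous density `h` with `|h(w)| ≤ K(1 + ‖w‖)^{−q}`;
§2 `S_c − S_{2c} = −∫ ∂ₑK_c(z) ∂_{e'}ΔP(y+z) dz` (`hessStep_eq_one`, one IBP; small scales) and
`= ∫ ∂_{e'}∂ₑK_c(z) ΔP(y+z) dz` (`hessStep_eq_two`, two IBPs; large scales), `‖D(∂ₑK_c)‖ ≤ 2M₂‖e‖/c³`
(tree scaling `D²Γ∞^{c,2c}(z) = c⁻³D²Γ∞^{1,2}(z/c)`); §3 per-scale bounds
`|S_c − S_{2c}| ≤ 1024 C_Γ K₃|B₁|‖e‖‖e'‖ c/(1+‖y‖)³` (`8c ≤ ‖y‖`, from `‖∇ΔP‖ ≤ K₃(1+r)^{−3}`) and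
`≤ 120 M₂ K₂|B₁|‖e‖‖e'‖/c²` (`‖y‖ ≤ 8c`, from `|ΔP| ≤ K₂(1+r)^{−2}`), both summable to `O(‖y‖⁻²)` — the
pressure-Hessian rate consumed by `CoriolisHeadTypeIRateOfLaplacianGradientDecay`.  Everything is proved; no
definitions.  WHAT THIS IS NOT: K1c, K1a, `NoCoRotatingCore` stay OPEN; nothing here proves NS regularity.
References: Gilbarg–Trudinger (2001) §4.2 [GilbargTrudinger2001]; Pineau–Vicol arXiv:2607.09619 [PineauVicol2026].
-/

noncomputable section

open MeasureTheory Set Function Filter Topology Metric InnerProductSpace Real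
open scoped RealInnerProductSpace Laplacian ContDiff

-- the summit and its single sub-problem share the name (CONVENTIONS §1), as in every Theorems file
set_option linter.dupNamespace false
-- nested operator types
set_option maxSynthPendingDepth 3

namespace Summit.NavierStokesRegularity.NavierStokesRegularity.Theorems.CoriolisHead

namespace TypeIRate

open Literature.Analysis.FluidPDE

/-! ## §1 Generic decay integrals (any continuous density `h` with `|h(w)| ≤ K(1 + ‖w‖)^{−q}`) -/

/-- Small scales (`8c ≤ ‖y‖`): `∫_{|z|≤4c} |h(y+z)| ≤ K 2^q (1+‖y‖)^{−q} |B̄(0,4c)|`. [folklore] -/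
theorem setIntegral_abs_le_of_decay_small {h : EuclideanSpace ℝ (Fin 3) → ℝ} {K q : ℝ} (hq : 0 ≤ q)
    (hh : ∀ w : EuclideanSpace ℝ (Fin 3), |h w| ≤ K / (1 + ‖w‖) ^ q)
    {y : EuclideanSpace ℝ (Fin 3)} {c : ℝ} (hc : 0 < c) (hcy : 8 * c ≤ ‖y‖) :
    ∫ z in closedBall (0 : EuclideanSpace ℝ (Fin 3)) (4 * c), |h (y + z)| ≤
      K * 2 ^ q / (1 + ‖y‖) ^ q * ((4 * c) ^ 3 * (volume (ball (0 : EuclideanSpace ℝ (Fin 3)) 1)).toReal) := by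
  have hK : 0 ≤ K := by
    have h := hh 0
    rw [norm_zero, add_zero, Real.one_rpow, div_one] at h
    exact (abs_nonneg _).trans h
  have hbound : ∀ z ∈ closedBall (0 : EuclideanSpace ℝ (Fin 3)) (4 * c),
      ‖|h (y + z)|‖ ≤ K * 2 ^ q / (1 + ‖y‖) ^ q := by
    intro z hz
    rw [mem_closedBall_zero_iff] at hz
    rw [Real.norm_eq_abs, abs_abs]
    refine (hh (y + z)).trans ?_
    have hyz : (1 + ‖y‖) / 2 ≤ 1 + ‖y + z‖ := by
      have h' : ‖y‖ ≤ ‖y + z‖ + ‖z‖ := by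
        have := norm_add_le (y + z) (-z); simp only [add_neg_cancel_right, norm_neg] at this; exact this
      linarith
    have hpos : 0 < (1 + ‖y‖) / 2 := by positivity
    have hpow : ((1 + ‖y‖) / 2) ^ q ≤ (1 + ‖y + z‖) ^ q := Real.rpow_le_rpow hpos.le hyz hq
    rw [Real.div_rpow (by positivity) zero_le_two] at hpow
    have h2q : 0 < (2 : ℝ) ^ q := Real.rpow_pos_of_pos two_pos _
    have h1q : 0 < (1 + ‖y‖) ^ q := Real.rpow_pos_of_pos (by positivity) _
    have h3q : 0 < (1 + ‖y + z‖) ^ q := Real.rpow_pos_of_pos (by positivity) _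
    rw [div_le_div_iff₀ h3q h1q]
    rw [div_le_iff₀ h2q] at hpow
    nlinarith [mul_le_mul_of_nonneg_left hpow hK]
  have h := norm_setIntegral_le_of_norm_le_const
    (measure_closedBall_lt_top : volume (closedBall (0 : EuclideanSpace ℝ (Fin 3)) (4 * c)) < ⊤) hbound
  rw [Real.norm_eq_abs] at h
  have h' := (le_abs_self _).trans h
  refine h'.trans (le_of_eq ?_)
  rw [show volume.real (closedBall (0 : EuclideanSpace ℝ (Fin 3)) (4 * c)) =
      (volume (closedBall (0 : EuclideanSpace ℝ (Fin 3)) (4 * c))).toReal from rfl,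
    volumeReal_closedBall_eq (by positivity : (0 : ℝ) ≤ 4 * c)]

/-- Large scales: `∫_{|z|≤4c} |h(y+z)| ≤ K · 3|B₁| (4c + ‖y‖ + 1)^{3−q}/(3 − q)` for continuous `h` and
`0 ≤ q < 3`. [folklore] -/
theorem setIntegral_abs_le_of_decay_large {h : EuclideanSpace ℝ (Fin 3) → ℝ} (hcont : Continuous h)
    {K q : ℝ} (hK : 0 ≤ K) (hq : 0 ≤ q) (hq3 : q < 3)
    (hh : ∀ w : EuclideanSpace ℝ (Fin 3), |h w| ≤ K / (1 + ‖w‖) ^ q)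
    (y : EuclideanSpace ℝ (Fin 3)) {c : ℝ} (hc : 0 < c) :
    ∫ z in closedBall (0 : EuclideanSpace ℝ (Fin 3)) (4 * c), |h (y + z)| ≤
      K * (3 * (volume (ball (0 : EuclideanSpace ℝ (Fin 3)) 1)).toReal *
        ((4 * c + ‖y‖ + 1) ^ (3 - q) / (3 - q))) := by
  set ρ : ℝ := 4 * c + ‖y‖ + 1 with hρ
  have hρpos : 0 < ρ := by positivity
  have hΔc : Continuous fun z : EuclideanSpace ℝ (Fin 3) => |h (y + z)| :=
    (hcont.comp (continuous_const.add continuous_id)).abs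
  have hsub : closedBall (0 : EuclideanSpace ℝ (Fin 3)) (4 * c) ⊆ (fun z => y + z) ⁻¹' ball 0 ρ := by
    intro z hz
    rw [mem_closedBall_zero_iff] at hz
    rw [mem_preimage, mem_ball_zero_iff]
    calc ‖y + z‖ ≤ ‖y‖ + ‖z‖ := norm_add_le _ _
      _ < ρ := by rw [hρ]; linarith
  set g : EuclideanSpace ℝ (Fin 3) → ℝ := fun w => (ball (0 : EuclideanSpace ℝ (Fin 3)) ρ).indicator
    (fun w => K * ‖w‖ ^ (-q)) w with hg
  have hgi : Integrable g := by
    rw [hg]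
    have hio : IntegrableOn (fun w : EuclideanSpace ℝ (Fin 3) => K * ‖w‖ ^ (-q)) (ball 0 ρ) :=
      (NewtonPotentialHolder.integrableOn_ball_norm_rpow_neg hq3 ρ).const_mul K
    exact hio.integrable_indicator measurableSet_ball
  have hg0 : ∀ w, 0 ≤ g w := fun w =>
    Set.indicator_nonneg (fun w _ => mul_nonneg hK (Real.rpow_nonneg (norm_nonneg _) _)) _
  have hae : (fun z => (closedBall (0 : EuclideanSpace ℝ (Fin 3)) (4 * c)).indicator
      (fun z => |h (y + z)|) z) ≤ᵐ[volume] fun z => g (y + z) := by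
    have hne : ∀ᵐ z : EuclideanSpace ℝ (Fin 3), z ≠ -y := by
      have : ({-y}ᶜ : Set (EuclideanSpace ℝ (Fin 3))) ∈ ae volume :=
        compl_mem_ae_iff.2 (measure_singleton _)
      filter_upwards [this] with z hz
      simpa using hz
    filter_upwards [hne] with z hz
    by_cases hzB : z ∈ closedBall (0 : EuclideanSpace ℝ (Fin 3)) (4 * c)
    · have hyz : y + z ∈ ball (0 : EuclideanSpace ℝ (Fin 3)) ρ := hsub hzB
      rw [Set.indicator_of_mem hzB]
      simp only [hg, Set.indicator_of_mem hyz]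
      have hw0 : y + z ≠ 0 := fun h => hz (by rw [← sub_eq_zero, sub_neg_eq_add, add_comm]; exact h)
      have hwpos : 0 < ‖y + z‖ := norm_pos_iff.2 hw0
      refine (hh (y + z)).trans ?_
      rw [div_eq_mul_inv, ← Real.rpow_neg (by positivity)]
      refine mul_le_mul_of_nonneg_left ?_ hK
      rw [Real.rpow_neg (by positivity), Real.rpow_neg hwpos.le]
      exact inv_anti₀ (Real.rpow_pos_of_pos hwpos _)
        (Real.rpow_le_rpow hwpos.le (by linarith) hq)
    · simp only [Set.indicator_of_notMem hzB]
      exact hg0 _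
  have hint1 : Integrable fun z => (closedBall (0 : EuclideanSpace ℝ (Fin 3)) (4 * c)).indicator
      (fun z => |h (y + z)|) z :=
    (hΔc.continuousOn.integrableOn_compact (isCompact_closedBall _ _)).integrable_indicator
      measurableSet_closedBall
  have hint2 : Integrable fun z => g (y + z) := hgi.comp_add_left y
  calc ∫ z in closedBall (0 : EuclideanSpace ℝ (Fin 3)) (4 * c), |h (y + z)|
      = ∫ z, (closedBall (0 : EuclideanSpace ℝ (Fin 3)) (4 * c)).indicator (fun z => |h (y + z)|) z :=
        (integral_indicator measurableSet_closedBall).symm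
    _ ≤ ∫ z, g (y + z) := integral_mono_ae hint1 hint2 hae
    _ = ∫ w, g w := integral_add_left_eq_self g y
    _ = K * ∫ w in ball (0 : EuclideanSpace ℝ (Fin 3)) ρ, ‖w‖ ^ (-q) := by
        rw [hg, integral_indicator measurableSet_ball, integral_const_mul]
    _ = K * (3 * (volume (ball (0 : EuclideanSpace ℝ (Fin 3)) 1)).toReal * (ρ ^ (3 - q) / (3 - q))) := by
        rw [NewtonPotentialHolder.integral_ball_norm_rpow_neg hq3 hρpos]
        rfl

/-- A kernel bound gives a set-integral bound: if `|k(z)| ≤ m` on `|z| ≤ 4c` and `k = 0` beyond, then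
`|∫ k(z) h(y+z) dz| ≤ m ∫_{|z|≤4c} |h(y+z)| dz` for continuous `h`. [folklore] -/
theorem abs_integral_kernel_mul_le {k h : EuclideanSpace ℝ (Fin 3) → ℝ} (hcont : Continuous h)
    {m c : ℝ} (hm0 : 0 ≤ m) (hk : ∀ z, |k z| ≤ m)
    (hk0 : ∀ z : EuclideanSpace ℝ (Fin 3), 4 * c < ‖z‖ → k z = 0) (y : EuclideanSpace ℝ (Fin 3)) :
    |∫ z, k z * h (y + z)| ≤ m * ∫ z in closedBall (0 : EuclideanSpace ℝ (Fin 3)) (4 * c), |h (y + z)| := by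
  have hΔc : Continuous fun z : EuclideanSpace ℝ (Fin 3) => h (y + z) :=
    hcont.comp (continuous_const.add continuous_id)
  have hpt : ∀ z, ‖k z * h (y + z)‖ ≤
      (closedBall (0 : EuclideanSpace ℝ (Fin 3)) (4 * c)).indicator (fun z => m * |h (y + z)|) z := by
    intro z
    by_cases hz : 4 * c < ‖z‖
    · rw [hk0 z hz, zero_mul, norm_zero]
      exact Set.indicator_nonneg (fun _ _ => mul_nonneg hm0 (abs_nonneg _)) _
    · rw [not_lt] at hz
      rw [Set.indicator_of_mem (mem_closedBall_zero_iff.2 hz), norm_mul, Real.norm_eq_abs,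
        Real.norm_eq_abs]
      exact mul_le_mul_of_nonneg_right (hk z) (abs_nonneg _)
  have hint : Integrable fun z => (closedBall (0 : EuclideanSpace ℝ (Fin 3)) (4 * c)).indicator
      (fun z => m * |h (y + z)|) z :=
    ((continuous_const.mul hΔc.abs).continuousOn.integrableOn_compact
      (isCompact_closedBall _ _)).integrable_indicator measurableSet_closedBall
  calc |∫ z, k z * h (y + z)|
      = ‖∫ z, k z * h (y + z)‖ := (Real.norm_eq_abs _).symm
    _ ≤ ∫ z, (closedBall (0 : EuclideanSpace ℝ (Fin 3)) (4 * c)).indicator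
          (fun z => m * |h (y + z)|) z := norm_integral_le_of_norm_le hint (Eventually.of_forall hpt)
    _ = m * ∫ z in closedBall (0 : EuclideanSpace ℝ (Fin 3)) (4 * c), |h (y + z)| := by
        rw [integral_indicator measurableSet_closedBall, integral_const_mul]

/-! ## §2 The centred shell steps of a SECOND derivative `∂ₑ∂_{e'}P` -/

/-- **First form of the Hessian step** (one integration by parts): with
`S_c = ∫ λ^{c,2c}(z) ∂ₑ∂_{e'}P(y + z) dz`, `S_c − S_{2c} = −∫ ∂ₑK_c(z) · ∂_{e'}(ΔP)(y + z) dz`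
(`shellStep_eq` applied to the smooth function `∂_{e'}P`, and `Δ∂_{e'} = ∂_{e'}Δ`). [folklore] -/
theorem hessStep_eq_one {P : EuclideanSpace ℝ (Fin 3) → ℝ} (hP : ContDiff ℝ ∞ P)
    (y e e' : EuclideanSpace ℝ (Fin 3)) {c : ℝ} (hc : 0 < c) :
    (∫ z, newtonFarLaplacian c (2 * c) z *
        fderiv ℝ (fun w => fderiv ℝ P w e') (y + z) e) -
      (∫ z, newtonFarLaplacian (2 * c) (4 * c) z *
        fderiv ℝ (fun w => fderiv ℝ P w e') (y + z) e) =
      -∫ z, fderiv ℝ (fun z : EuclideanSpace ℝ (Fin 3) => newtonFar c (2 * c) z - newtonFar (2 * c) (4 * c) z) z e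
        * fderiv ℝ (Δ P) (y + z) e' := by
  have hP' : ContDiff ℝ ∞ (fun w => fderiv ℝ P w e') :=
    (hP.fderiv_right (m := ∞) le_rfl).clm_apply contDiff_const
  have hP3 : ContDiff ℝ 3 P := hP.of_le (by norm_cast)
  have h := shellStep_eq hP' y e hc
  have hΔ : ∀ w, (Δ (fun w => fderiv ℝ P w e')) w = fderiv ℝ (Δ P) w e' := fun w =>
    (fderiv_laplacian_apply hP3 w e').symm
  simp only [hΔ] at h
  exact h

/-- **Second form of the Hessian step** (two integrations by parts):
`S_c − S_{2c} = ∫ ∂_{e'}∂ₑK_c(z) · ΔP(y + z) dz`. [folklore] -/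
theorem hessStep_eq_two {P : EuclideanSpace ℝ (Fin 3) → ℝ} (hP : ContDiff ℝ ∞ P)
    (y e e' : EuclideanSpace ℝ (Fin 3)) {c : ℝ} (hc : 0 < c) :
    (∫ z, newtonFarLaplacian c (2 * c) z *
        fderiv ℝ (fun w => fderiv ℝ P w e') (y + z) e) -
      (∫ z, newtonFarLaplacian (2 * c) (4 * c) z *
        fderiv ℝ (fun w => fderiv ℝ P w e') (y + z) e) =
      ∫ z, fderiv ℝ (fun z : EuclideanSpace ℝ (Fin 3) => fderiv ℝ
          (fun z : EuclideanSpace ℝ (Fin 3) => newtonFar c (2 * c) z - newtonFar (2 * c) (4 * c) z) z e) z e'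
        * (Δ P) (y + z) := by
  rw [hessStep_eq_one hP y e e' hc]
  set K : EuclideanSpace ℝ (Fin 3) → ℝ := fun z => newtonFar c (2 * c) z - newtonFar (2 * c) (4 * c) z
    with hKdef
  have hK : ContDiff ℝ ∞ K := contDiff_shellKernel hc
  have hKc : HasCompactSupport K := hasCompactSupport_shellKernel hc
  have hKe : ContDiff ℝ 1 (fun z => fderiv ℝ K z e) :=
    ((hK.fderiv_right (m := 1) (by norm_cast)).clm_apply contDiff_const)
  have hKec : HasCompactSupport (fun z => fderiv ℝ K z e) := hKc.fderiv_apply (𝕜 := ℝ) e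
  have hf : ContDiff ℝ 1 (fun z : EuclideanSpace ℝ (Fin 3) => (Δ P) (y + z)) :=
    (contDiff_laplacian (n := 1) (hP.of_le (by norm_cast))).comp (contDiff_const.add contDiff_id)
  -- integrate `∂_{e'}` of the product `∂ₑK · ΔP(y + ·)`
  have hprod : ContDiff ℝ 1 fun z => fderiv ℝ K z e * (Δ P) (y + z) := hKe.mul hf
  have hzero := integral_fderiv_apply_eq_zero hprod hKec.mul_right e'
  have hderiv : ∀ z, fderiv ℝ (fun z => fderiv ℝ K z e * (Δ P) (y + z)) z e' =
      fderiv ℝ (fun z => fderiv ℝ K z e) z e' * (Δ P) (y + z) +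
        fderiv ℝ K z e * fderiv ℝ (fun z : EuclideanSpace ℝ (Fin 3) => (Δ P) (y + z)) z e' := by
    intro z
    rw [fderiv_fun_mul ((hKe.differentiable one_ne_zero) z) ((hf.differentiable one_ne_zero) z)]
    simp only [FunLike.coe_add, FunLike.coe_smul, Pi.add_apply, Pi.smul_apply, smul_eq_mul]
    ring
  simp_rw [hderiv] at hzero
  have hi1 : Integrable fun z => fderiv ℝ (fun z => fderiv ℝ K z e) z e' * (Δ P) (y + z) :=
    ((((hKe.continuous_fderiv one_ne_zero).clm_apply continuous_const).mul hf.continuous)).integrable_of_hasCompactSupport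
      ((hKec.fderiv_apply (𝕜 := ℝ) e').mul_right)
  have hi2 : Integrable fun z => fderiv ℝ K z e *
      fderiv ℝ (fun z : EuclideanSpace ℝ (Fin 3) => (Δ P) (y + z)) z e' :=
    (hKe.continuous.mul ((hf.continuous_fderiv one_ne_zero).clm_apply continuous_const)).integrable_of_hasCompactSupport
      hKec.mul_right
  rw [integral_add hi1 hi2] at hzero
  have hi2' : (∫ z, fderiv ℝ K z e * fderiv ℝ (Δ P) (y + z) e') =
      ∫ z, fderiv ℝ K z e * fderiv ℝ (fun z : EuclideanSpace ℝ (Fin 3) => (Δ P) (y + z)) z e' := by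
    refine integral_congr_ae (Eventually.of_forall fun z => ?_)
    simp only [fderiv_comp_add_left]
  linarith

/-- **Second-derivative bound for the telescoping kernel**: with `M₂ = sup ‖D²Γ∞^{1,2}‖`,
`‖D(∂ₑK_c)(z)‖ ≤ 2M₂‖e‖/c³` (scaling `D²Γ∞^{c,2c}(z) = c⁻³ D²Γ∞^{1,2}(z/c)`). [folklore] -/
theorem norm_fderiv_fderiv_shellKernel_le {M₂ : ℝ}
    (hM₂ : ∀ w : EuclideanSpace ℝ (Fin 3), ‖fderiv ℝ (fderiv ℝ (newtonFar 1 2)) w‖ ≤ M₂)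
    {c : ℝ} (hc : 0 < c) (e z : EuclideanSpace ℝ (Fin 3)) :
    ‖fderiv ℝ (fun z : EuclideanSpace ℝ (Fin 3) => fderiv ℝ
        (fun z : EuclideanSpace ℝ (Fin 3) => newtonFar c (2 * c) z - newtonFar (2 * c) (4 * c) z) z e) z‖ ≤
      2 * M₂ * ‖e‖ / c ^ 3 := by
  have hM₂0 : 0 ≤ M₂ := (norm_nonneg _).trans (hM₂ 0)
  set K : EuclideanSpace ℝ (Fin 3) → ℝ := fun z => newtonFar c (2 * c) z - newtonFar (2 * c) (4 * c) z
    with hKdef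
  have h1 : ContDiff ℝ 2 (newtonFar c (2 * c) : EuclideanSpace ℝ (Fin 3) → ℝ) := contDiff_newtonFar hc (by linarith)
  have h2 : ContDiff ℝ 2 (newtonFar (2 * c) (4 * c) : EuclideanSpace ℝ (Fin 3) → ℝ) :=
    contDiff_newtonFar (by linarith) (by linarith)
  have hK : ContDiff ℝ 2 K := h1.sub h2
  have hDK : Differentiable ℝ (fderiv ℝ K) := (hK.fderiv_right (m := 1) (by norm_cast)).differentiable one_ne_zero
  -- `D(∂ₑK)(z) = (D²K z).flip e`
  have hfe : fderiv ℝ (fun z => fderiv ℝ K z e) z = (fderiv ℝ (fderiv ℝ K) z).flip e := by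
    rw [((hDK z).hasFDerivAt.clm_apply (hasFDerivAt_const e z)).fderiv, ContinuousLinearMap.comp_zero, zero_add]
  rw [hfe]
  have hflip : ‖(fderiv ℝ (fderiv ℝ K) z).flip e‖ ≤ ‖fderiv ℝ (fderiv ℝ K) z‖ * ‖e‖ := by
    have := ((fderiv ℝ (fderiv ℝ K) z).flip).le_opNorm e
    rwa [ContinuousLinearMap.opNorm_flip] at this
  refine hflip.trans ?_
  -- `D²K = D²Γ∞^{c,2c} − D²Γ∞^{2c,4c}`
  have hDKeq : fderiv ℝ K = fun z => fderiv ℝ (newtonFar c (2 * c)) z - fderiv ℝ (newtonFar (2 * c) (4 * c)) z := by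
    funext w
    exact fderiv_sub ((h1.differentiable (by norm_num)) w) ((h2.differentiable (by norm_num)) w)
  have hD2 : fderiv ℝ (fderiv ℝ K) z =
      fderiv ℝ (fderiv ℝ (newtonFar c (2 * c))) z - fderiv ℝ (fderiv ℝ (newtonFar (2 * c) (4 * c))) z := by
    rw [hDKeq]
    exact fderiv_sub (((h1.fderiv_right (m := 1) (by norm_cast)).differentiable one_ne_zero) z)
      (((h2.fderiv_right (m := 1) (by norm_cast)).differentiable one_ne_zero) z)
  -- scaling
  have hs1 : ‖fderiv ℝ (fderiv ℝ (newtonFar c (2 * c))) z‖ ≤ M₂ / c ^ 3 := by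
    have h := fderiv2_newtonFar_scale hc 1 2 z
    rw [mul_one, mul_comm c 2] at h
    rw [h, norm_smul, norm_pow, norm_inv, Real.norm_of_nonneg hc.le]
    calc c⁻¹ ^ 3 * ‖fderiv ℝ (fderiv ℝ (newtonFar 1 2)) (c⁻¹ • z)‖ ≤ c⁻¹ ^ 3 * M₂ :=
          mul_le_mul_of_nonneg_left (hM₂ _) (by positivity)
      _ = M₂ / c ^ 3 := by rw [inv_pow, div_eq_mul_inv, mul_comm]
  have hs2 : ‖fderiv ℝ (fderiv ℝ (newtonFar (2 * c) (4 * c))) z‖ ≤ M₂ / c ^ 3 := by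
    have hc2 : 0 < 2 * c := by linarith
    have h := fderiv2_newtonFar_scale hc2 1 2 z
    rw [mul_one, show 2 * c * 2 = 4 * c by ring] at h
    rw [h, norm_smul, norm_pow, norm_inv, Real.norm_of_nonneg hc2.le]
    calc (2 * c)⁻¹ ^ 3 * ‖fderiv ℝ (fderiv ℝ (newtonFar 1 2)) ((2 * c)⁻¹ • z)‖
        ≤ (2 * c)⁻¹ ^ 3 * M₂ := mul_le_mul_of_nonneg_left (hM₂ _) (by positivity)
      _ ≤ c⁻¹ ^ 3 * M₂ := by
          refine mul_le_mul_of_nonneg_right ?_ hM₂0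
          exact pow_le_pow_left₀ (by positivity) (by rw [inv_le_inv₀ hc2 hc]; linarith) 3
      _ = M₂ / c ^ 3 := by rw [div_eq_mul_inv, mul_comm, inv_pow]
  rw [hD2]
  calc ‖fderiv ℝ (fderiv ℝ (newtonFar c (2 * c))) z - fderiv ℝ (fderiv ℝ (newtonFar (2 * c) (4 * c))) z‖ * ‖e‖
      ≤ (M₂ / c ^ 3 + M₂ / c ^ 3) * ‖e‖ :=
        mul_le_mul_of_nonneg_right ((norm_sub_le _ _).trans (add_le_add hs1 hs2)) (norm_nonneg _)
    _ = 2 * M₂ * ‖e‖ / c ^ 3 := by ring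

/-- `D(∂ₑK_c) = 0` beyond `|z| = 4c` (the kernel vanishes identically there). [folklore] -/
theorem fderiv_fderiv_shellKernel_eq_zero_of_lt {c : ℝ} (hc : 0 < c) (e : EuclideanSpace ℝ (Fin 3))
    {z : EuclideanSpace ℝ (Fin 3)} (hz : 4 * c < ‖z‖) :
    fderiv ℝ (fun z : EuclideanSpace ℝ (Fin 3) => fderiv ℝ
        (fun z : EuclideanSpace ℝ (Fin 3) => newtonFar c (2 * c) z - newtonFar (2 * c) (4 * c) z) z e) z = 0 := by
  have hev : (fun w : EuclideanSpace ℝ (Fin 3) => fderiv ℝ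
      (fun z : EuclideanSpace ℝ (Fin 3) => newtonFar c (2 * c) z - newtonFar (2 * c) (4 * c) z) w e)
      =ᶠ[𝓝 z] fun _ => (0 : ℝ) := by
    have hopen : IsOpen {w : EuclideanSpace ℝ (Fin 3) | 4 * c < ‖w‖} := isOpen_lt continuous_const continuous_norm
    filter_upwards [hopen.mem_nhds hz] with w hw
    rw [fderiv_shellKernel_eq_zero_of_lt hc hw]
    rfl
  rw [hev.fderiv_eq, fderiv_const_apply]

/-! ## §3 Per-scale bounds for the Hessian steps -/

/-- **Small-scale Hessian step** (`8c ≤ ‖y‖`), via the first form and `‖∇ΔP(w)‖ ≤ K₃(1+‖w‖)^{−3}`: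
`|S_c − S_{2c}| ≤ 1024·C_Γ K₃ |B₁| ‖e‖‖e'‖ · c/(1 + ‖y‖)³`. [folklore] -/
theorem abs_hessStep_le_small {C : ℝ} (hC0 : 0 ≤ C)
    (hC : ∀ w : EuclideanSpace ℝ (Fin 3), ‖w‖ ^ 2 * ‖fderiv ℝ (newtonFar 1 2) w‖ ≤ C)
    {P : EuclideanSpace ℝ (Fin 3) → ℝ} (hP : ContDiff ℝ ∞ P) {K₃ : ℝ}
    (hΔ' : ∀ w : EuclideanSpace ℝ (Fin 3), ‖fderiv ℝ (Δ P) w‖ ≤ K₃ / (1 + ‖w‖) ^ (3 : ℝ))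
    (y e e' : EuclideanSpace ℝ (Fin 3)) {c : ℝ} (hc : 0 < c) (hcy : 8 * c ≤ ‖y‖) :
    |(∫ z, newtonFarLaplacian c (2 * c) z * fderiv ℝ (fun w => fderiv ℝ P w e') (y + z) e) -
        (∫ z, newtonFarLaplacian (2 * c) (4 * c) z * fderiv ℝ (fun w => fderiv ℝ P w e') (y + z) e)| ≤
      1024 * C * K₃ * (volume (ball (0 : EuclideanSpace ℝ (Fin 3)) 1)).toReal * ‖e‖ * ‖e'‖ *
        (c / (1 + ‖y‖) ^ (3 : ℝ)) := by
  rw [hessStep_eq_one hP y e e' hc, abs_neg]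
  have hcont : Continuous fun w : EuclideanSpace ℝ (Fin 3) => fderiv ℝ (Δ P) w e' :=
    ((contDiff_laplacian (n := 1) (hP.of_le (by norm_cast))).continuous_fderiv one_ne_zero).clm_apply
      continuous_const
  have hk : ∀ z, |fderiv ℝ (fun z : EuclideanSpace ℝ (Fin 3) => newtonFar c (2 * c) z - newtonFar (2 * c) (4 * c) z)
      z e| ≤ 2 * C * ‖e‖ / c ^ 2 := fun z => by
    rw [← Real.norm_eq_abs]
    calc ‖fderiv ℝ (fun z : EuclideanSpace ℝ (Fin 3) => newtonFar c (2 * c) z - newtonFar (2 * c) (4 * c) z) z e‖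
        ≤ ‖fderiv ℝ (fun z : EuclideanSpace ℝ (Fin 3) => newtonFar c (2 * c) z - newtonFar (2 * c) (4 * c) z) z‖
            * ‖e‖ := ContinuousLinearMap.le_opNorm _ _
      _ ≤ 2 * C / c ^ 2 * ‖e‖ := mul_le_mul_of_nonneg_right (norm_fderiv_shellKernel_le hC0 hC hc z) (norm_nonneg _)
      _ = 2 * C * ‖e‖ / c ^ 2 := by ring
  have h1 := abs_integral_kernel_mul_le hcont (by positivity : 0 ≤ 2 * C * ‖e‖ / c ^ 2) hk
    (fun z hz => by rw [fderiv_shellKernel_eq_zero_of_lt hc hz]; rfl) y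
  have hh : ∀ w : EuclideanSpace ℝ (Fin 3), |fderiv ℝ (Δ P) w e'| ≤ K₃ * ‖e'‖ / (1 + ‖w‖) ^ (3 : ℝ) :=
    fun w => by
    rw [← Real.norm_eq_abs]
    calc ‖fderiv ℝ (Δ P) w e'‖ ≤ ‖fderiv ℝ (Δ P) w‖ * ‖e'‖ := ContinuousLinearMap.le_opNorm _ _
      _ ≤ K₃ / (1 + ‖w‖) ^ (3 : ℝ) * ‖e'‖ := mul_le_mul_of_nonneg_right (hΔ' w) (norm_nonneg _)
      _ = K₃ * ‖e'‖ / (1 + ‖w‖) ^ (3 : ℝ) := by ring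
  have h2 := setIntegral_abs_le_of_decay_small (h := fun w => fderiv ℝ (Δ P) w e') (by norm_num : (0:ℝ) ≤ 3)
    hh hc hcy
  refine h1.trans ((mul_le_mul_of_nonneg_left h2 (by positivity)).trans (le_of_eq ?_))
  rw [show (2 : ℝ) ^ (3 : ℝ) = 8 by norm_num]
  field_simp
  ring

/-- **Large-scale Hessian step** (`‖y‖ ≤ 8c`, `1 ≤ 8c`), via the second form and `|ΔP(w)| ≤ K₂(1+‖w‖)^{−2}`:
`|S_c − S_{2c}| ≤ 120·M₂ K₂ |B₁| ‖e‖‖e'‖ / c²`. [folklore] -/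
theorem abs_hessStep_le_large {M₂ : ℝ}
    (hM₂ : ∀ w : EuclideanSpace ℝ (Fin 3), ‖fderiv ℝ (fderiv ℝ (newtonFar 1 2)) w‖ ≤ M₂)
    {P : EuclideanSpace ℝ (Fin 3) → ℝ} (hP : ContDiff ℝ ∞ P) {K₂ : ℝ} (hK₂ : 0 ≤ K₂)
    (hΔ : ∀ w : EuclideanSpace ℝ (Fin 3), |(Δ P) w| ≤ K₂ / (1 + ‖w‖) ^ (2 : ℝ))
    (y e e' : EuclideanSpace ℝ (Fin 3)) {c : ℝ} (hc : 0 < c) (hyc : ‖y‖ ≤ 8 * c) (h1c : 1 ≤ 8 * c) :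
    |(∫ z, newtonFarLaplacian c (2 * c) z * fderiv ℝ (fun w => fderiv ℝ P w e') (y + z) e) -
        (∫ z, newtonFarLaplacian (2 * c) (4 * c) z * fderiv ℝ (fun w => fderiv ℝ P w e') (y + z) e)| ≤
      120 * M₂ * K₂ * (volume (ball (0 : EuclideanSpace ℝ (Fin 3)) 1)).toReal * ‖e‖ * ‖e'‖ / c ^ 2 := by
  have hM₂0 : 0 ≤ M₂ := (norm_nonneg _).trans (hM₂ 0)
  rw [hessStep_eq_two hP y e e' hc]
  have hcont : Continuous (Δ P) := Literature.Analysis.FluidPDE.continuous_laplacian (hP.of_le (by norm_cast))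
  have hk : ∀ z, |fderiv ℝ (fun z : EuclideanSpace ℝ (Fin 3) => fderiv ℝ
      (fun z : EuclideanSpace ℝ (Fin 3) => newtonFar c (2 * c) z - newtonFar (2 * c) (4 * c) z) z e) z e'| ≤
      2 * M₂ * ‖e‖ * ‖e'‖ / c ^ 3 := fun z => by
    rw [← Real.norm_eq_abs]
    refine (ContinuousLinearMap.le_opNorm _ _).trans ?_
    calc ‖fderiv ℝ (fun z : EuclideanSpace ℝ (Fin 3) => fderiv ℝ
          (fun z : EuclideanSpace ℝ (Fin 3) => newtonFar c (2 * c) z - newtonFar (2 * c) (4 * c) z) z e) z‖ * ‖e'‖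
        ≤ 2 * M₂ * ‖e‖ / c ^ 3 * ‖e'‖ :=
          mul_le_mul_of_nonneg_right (norm_fderiv_fderiv_shellKernel_le hM₂ hc e z) (norm_nonneg _)
      _ = 2 * M₂ * ‖e‖ * ‖e'‖ / c ^ 3 := by ring
  have h1 := abs_integral_kernel_mul_le hcont (by positivity : 0 ≤ 2 * M₂ * ‖e‖ * ‖e'‖ / c ^ 3) hk
    (fun z hz => by rw [fderiv_fderiv_shellKernel_eq_zero_of_lt hc e hz]; rfl) y
  have h2 := setIntegral_abs_le_of_decay_large hcont hK₂ (by norm_num : (0:ℝ) ≤ 2) (by norm_num : (2:ℝ) < 3)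
    hΔ y hc
  set V₁ : ℝ := (volume (ball (0 : EuclideanSpace ℝ (Fin 3)) 1)).toReal with hV₁
  have hV₁0 : 0 ≤ V₁ := ENNReal.toReal_nonneg
  have hρ : (4 * c + ‖y‖ + 1) ^ ((3 : ℝ) - 2) / (3 - 2) ≤ 20 * c := by
    rw [show (3 : ℝ) - 2 = 1 by norm_num, Real.rpow_one, div_one]
    linarith
  have h3 : ∫ z in closedBall (0 : EuclideanSpace ℝ (Fin 3)) (4 * c), |(Δ P) (y + z)| ≤ K₂ * (3 * V₁ * (20 * c)) :=
    h2.trans (mul_le_mul_of_nonneg_left (mul_le_mul_of_nonneg_left hρ (by positivity)) hK₂)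
  refine h1.trans ((mul_le_mul_of_nonneg_left h3 (by positivity)).trans (le_of_eq ?_))
  field_simp
  ring

end TypeIRate

end Summit.NavierStokesRegularity.NavierStokesRegularity.Theorems.CoriolisHead

end
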